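import Mathlib
import HarnessLib
import Summits.Ventures.LatticeQCDFlow.Scaling.LossCouplingInversion
import Summits.Ventures.LatticeQCDFlow.Scaling.CumulantGeneralDiagonal

/-!
# LatticeQCDFlow / Scaling — THE LOSS DETERMINES THE ESS: `n·KL_n(β_n) → D` ⇒ partition function
# `M(β_n)^n → e^{D}`, Kish ESS fraction `→ e^{−2D}`, Bhattacharyya ceiling `→ e^{−D/2}`; and the
# equivalence `n·cgf(β_n) → D ⇔ β_n√n → √(2D/σ²)`

HONEST FRAMING: exact (Metropolis-corrected) sampling algorithms for lattice gauge theory;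
figures of merit are autocorrelation/cost numbers at stated couplings and volumes; no
continuum-physics claim.

Venture `LatticeQCDFlow` (cell pub-lqcd), topic `Scaling`; FANOUT row 3 (`s0-u1-a`, S0-B
implementation A, GEN-20).  NEW WORK of the cell — assembly of row 3's `Scaling/LossCouplingInversion`
(`n·cgf(β_n) → D ⇒ β_n√n → √(2D/σ²)`) and GEN-19's `Scaling/CumulantGeneralDiagonal` (along every
sequence with `β_n√n → c`: `n·cgf(β_n) → c²σ²/2`, `M(β_n)^n → e^{c²σ²/2}`, ESS fraction `→ e^{−c²σ²}`);
NO definition is introduced; nothing is cited.  Setting: bounded measurable centred non-degenerate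
block statistic `g` (`|g| ≤ K`, `∫ g dν = 0`, `σ² = Var g ≠ 0`), `n` i.i.d. blocks, non-negative
couplings `β_n`; the total reverse training loss of the untrained sampler is `n·cgf(β_n)`
(`Scaling/TiltKLDivergence`).

## Content (all `[ours]`)

* **`nat_mul_cgf_tendsto_iff_sqrt_mul_tendsto`** — for `D ≥ 0`:
  `n·cgf(β_n) → D ⇔ β_n·√n → √(2D/σ²)`: the loss and the diagonal constant determine each other;
* `tiltPi_mgf_pow_tendsto_of_loss_tendsto` — `n·cgf(β_n) → D ⇒ M(β_n)^n → e^{D}` (any real `β_n`);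
  **`tiltPi_essFrac_tendsto_of_loss_tendsto`** — the Kish fraction `(M(β_n)²/M(2β_n))^n → e^{−2D}`
  and **`tiltPi_ceiling_tendsto_of_loss_tendsto`** — the Bhattacharyya ceiling
  `(M(β_n/2)²/M(β_n))^n → e^{−D/2}`.

Reading (value-free): with `Scaling/AcceptanceAlongCouplingSequences` (acceptance `→ erfc(√(D/2))`)
the three figures of merit of the untrained sampler at large volume are functions of the limiting
training loss `D` alone: `ESS = e^{−2D}`, `BC² = e^{−D/2}`, `acc = erfc(√(D/2))`.
NOT CLAIMED: negative couplings; rates; trained flows; any value at the cell's `(β, L)`;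
nothing re-scored.
-/

noncomputable section

namespace Summit.Ventures.LatticeQCDFlow.Theory2

open MeasureTheory ProbabilityTheory Filter Finset Real Set
open scoped Topology NNReal

section LossEss

variable {X : Type*} {mX : MeasurableSpace X} {ν : Measure X} [IsProbabilityMeasure ν] {g : X → ℝ}

/-- **THE LOSS AND THE DIAGONAL CONSTANT DETERMINE EACH OTHER**: for `β_n ≥ 0` and `D ≥ 0`,
`n·cgf(β_n) → D ⇔ β_n·√n → √(2D/σ²)`. [ours] -/
theorem nat_mul_cgf_tendsto_iff_sqrt_mul_tendsto (hgm : Measurable g) {K : ℝ} (hK : ∀ x, |g x| ≤ K)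
    (h0 : ∫ x, g x ∂ν = 0) (hσ : Var[g; ν] ≠ 0) {β : ℕ → ℝ} (hβ0 : ∀ n, 0 ≤ β n) {D : ℝ}
    (hD0 : 0 ≤ D) :
    Tendsto (fun n : ℕ => (n : ℝ) * cgf g ν (β n)) atTop (𝓝 D)
      ↔ Tendsto (fun n : ℕ => β n * Real.sqrt n) atTop (𝓝 (Real.sqrt (2 * D / Var[g; ν]))) := by
  have hv : 0 < Var[g; ν] := lt_of_le_of_ne (variance_nonneg _ _) (Ne.symm hσ)
  have hgb : ∀ᵐ x ∂ν, g x ∈ Set.Icc (-K) K := ae_of_all _ fun x => abs_le.1 (hK x)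
  refine ⟨sqrt_mul_tendsto_of_nat_mul_cgf_tendsto hgm hK h0 hσ hβ0, fun h => ?_⟩
  have h' := tendsto_nat_mul_cgf_of_sqrt_mul_tendsto hgm.aemeasurable hgb h0 h
  have e : Real.sqrt (2 * D / Var[g; ν]) ^ 2 * Var[g; ν] / 2 = D := by
    rw [Real.sq_sqrt (by positivity)]
    field_simp
  rw [e] at h'
  exact h'

/-- **The partition function along the loss**: `n·cgf(β_n) → D ⇒ M(β_n)^n → e^{D}`. [ours] -/
theorem tiltPi_mgf_pow_tendsto_of_loss_tendsto (hgm : Measurable g) {K : ℝ} (hK : ∀ x, |g x| ≤ K)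
    {β : ℕ → ℝ} {D : ℝ} (hD : Tendsto (fun n : ℕ => (n : ℝ) * cgf g ν (β n)) atTop (𝓝 D)) :
    Tendsto (fun n : ℕ => mgf g ν (β n) ^ n) atTop (𝓝 (Real.exp D)) := by
  have hgb : ∀ᵐ x ∂ν, g x ∈ Set.Icc (-K) K := ae_of_all _ fun x => abs_le.1 (hK x)
  have hi : ∀ u : ℝ, Integrable (fun x => Real.exp (u * g x)) ν := fun u =>
    integrable_exp_mul_of_mem_Icc hgm.aemeasurable hgb
  have h := (Real.continuous_exp.tendsto _).comp hD
  refine h.congr fun n => ?_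
  simp only [Function.comp_apply]
  rw [← exp_cgf (hi _), ← Real.exp_nat_mul]

/-- **THE LOSS DETERMINES THE ESS**: `β_n ≥ 0`, `n·cgf(β_n) → D` ⇒ the Kish effective-sample-size
fraction `(M(β_n)²/M(2β_n))^n → e^{−2D}`. [ours] -/
theorem tiltPi_essFrac_tendsto_of_loss_tendsto (hgm : Measurable g) {K : ℝ} (hK : ∀ x, |g x| ≤ K)
    (h0 : ∫ x, g x ∂ν = 0) (hσ : Var[g; ν] ≠ 0) {β : ℕ → ℝ} (hβ0 : ∀ n, 0 ≤ β n) {D : ℝ}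
    (hD : Tendsto (fun n : ℕ => (n : ℝ) * cgf g ν (β n)) atTop (𝓝 D)) :
    Tendsto (fun n : ℕ => (mgf g ν (β n) ^ 2 / mgf g ν (2 * β n)) ^ n) atTop
      (𝓝 (Real.exp (-(2 * D)))) := by
  have hv : 0 < Var[g; ν] := lt_of_le_of_ne (variance_nonneg _ _) (Ne.symm hσ)
  have hgb : ∀ᵐ x ∂ν, g x ∈ Set.Icc (-K) K := ae_of_all _ fun x => abs_le.1 (hK x)
  have hD0 : 0 ≤ D :=
    ge_of_tendsto' hD fun n => mul_nonneg (Nat.cast_nonneg n) (cgf_nonneg_of_centred hgm hK h0 _)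
  have hc := sqrt_mul_tendsto_of_nat_mul_cgf_tendsto hgm hK h0 hσ hβ0 hD
  have h := tendsto_essFrac_of_sqrt_mul_tendsto hgm.aemeasurable hgb h0 hc
  have e : Real.sqrt (2 * D / Var[g; ν]) ^ 2 * Var[g; ν] = 2 * D := by
    rw [Real.sq_sqrt (by positivity)]
    field_simp
  rw [e] at h
  exact h

/-- **THE LOSS DETERMINES THE BHATTACHARYYA CEILING**: `β_n ≥ 0`, `n·cgf(β_n) → D` ⇒ the acceptance
ceiling `(M(β_n/2)²/M(β_n))^n → e^{−D/2}` (row 3's `Scaling/AcceptanceVolumeCeilingPi`). [ours] -/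
theorem tiltPi_ceiling_tendsto_of_loss_tendsto (hgm : Measurable g) {K : ℝ} (hK : ∀ x, |g x| ≤ K)
    (h0 : ∫ x, g x ∂ν = 0) (hσ : Var[g; ν] ≠ 0) {β : ℕ → ℝ} (hβ0 : ∀ n, 0 ≤ β n) {D : ℝ}
    (hD : Tendsto (fun n : ℕ => (n : ℝ) * cgf g ν (β n)) atTop (𝓝 D)) :
    Tendsto (fun n : ℕ => (mgf g ν (β n / 2) ^ 2 / mgf g ν (β n)) ^ n) atTop
      (𝓝 (Real.exp (-(D / 2)))) := by
  have hv : 0 < Var[g; ν] := lt_of_le_of_ne (variance_nonneg _ _) (Ne.symm hσ)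
  have hgb : ∀ᵐ x ∂ν, g x ∈ Set.Icc (-K) K := ae_of_all _ fun x => abs_le.1 (hK x)
  have hD0 : 0 ≤ D :=
    ge_of_tendsto' hD fun n => mul_nonneg (Nat.cast_nonneg n) (cgf_nonneg_of_centred hgm hK h0 _)
  have hc := sqrt_mul_tendsto_of_nat_mul_cgf_tendsto hgm hK h0 hσ hβ0 hD
  set c : ℝ := Real.sqrt (2 * D / Var[g; ν]) with hcdef
  have hc2 : Tendsto (fun n : ℕ => β n / 2 * Real.sqrt n) atTop (𝓝 (c / 2)) := by
    have := hc.div_const 2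
    refine this.congr fun n => ?_
    ring
  have h1 := tendsto_mgf_pow_of_sqrt_mul_tendsto hgm.aemeasurable hgb h0 hc2
  have h2 := tiltPi_mgf_pow_tendsto_of_loss_tendsto hgm hK hD
  have h := (h1.pow 2).div h2 (Real.exp_pos _).ne'
  have hcv : c ^ 2 * Var[g; ν] = 2 * D := by
    rw [hcdef, Real.sq_sqrt (by positivity)]
    field_simp
  have e : Real.exp ((c / 2) ^ 2 * Var[g; ν] / 2) ^ 2 / Real.exp D = Real.exp (-(D / 2)) := by
    rw [← Real.exp_nat_mul, ← Real.exp_sub]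
    congr 1
    have : (c / 2) ^ 2 * Var[g; ν] = (c ^ 2 * Var[g; ν]) / 4 := by ring
    rw [this, hcv]
    push_cast
    ring
  rw [e] at h
  refine h.congr fun n => ?_
  simp only [Pi.div_apply]
  rw [div_pow, ← pow_mul, ← pow_mul, mul_comm n 2]

end LossEss

end Summit.Ventures.LatticeQCDFlow.Theory2

end
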